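import Summits.CriticalPhenomena.PercolationContinuityZ3.Theorems.Transplant.FKConnectivityAllQAntipodalRootFormRealDefs
import Summits.CriticalPhenomena.PercolationContinuityZ3.Theorems.Transplant.FKConnectivityAllQAntipodalRootFormApex
import Summits.CriticalPhenomena.PercolationContinuityZ3.Theorems.Transplant.FKConnectivityAllQAntipodalMajMixNested
import HarnessLib

/-!
# Connectivity correlation inequalities for `φ_{w,q}`, every `q > 0` — ROOT-FORM CALCULUS, file 61m: REAL BOXES satisfy the hypotheses of
# THEOREM G27 (consistency of the local types; the single-box inequalities A4n, A1, A3n from Theorem U)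

Support file (`--supports stmt-CriticalPhenomena-4575`), FK sub-lane `prim-bschramm-fk-2` (gen 29); builds on p205010 (kernel theorem,
internal audit signed; external expert review pending).  No definitions, no named facts, no sorries; standard axioms.  Memo
FROM-fk-2-g28-ROOT-FORM.md §7 (L4a), FK-Q2 §37–§38.

A real box is a two-terminal series–parallel edge set `B` between its poles `a, b` with a special edge `y = uv ∈ B` and a cell `M` (free),
`C` (contracted) inside `B \ y`; its table `FK.RootForm.realBox M C a b y : ↥M.powerset → Base.BDat` (file 61k) records, for every
configuration, the level `apExpC (insert y M) C` and the pole bits of the two replicas at the two states of `y`.  This file discharges, for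
real boxes, the four hypotheses under which `FK.RootForm.Base.thetaPair_Mt_nonneg` (THEOREM G27, file 61e) holds:
* `realBox_consistent` — every local type is one of the 21 consistent types (`Cert.consistentB`): flipping `y` into replica 1 changes the
  level by `1{u↮v in replica 2} − 1{u↮v in replica 1}` (`FK.clusterCount_insert_add_ite`) and can only create pole connections in replica 1 /
  destroy them in replica 2, and only when `u ↮ v` there (`Wheel.reachable_coe_insert_iff`);
* `realBox_A4n` — root-U at an exact level read by a nested pair = `FK.apUpcCLW_nonneg_of_isTTSP` on `B` with the level weight `1{· = K}`
  against the glued test function of `FK.nestedTest_mono`;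
* `realBox_A1` — the pivot inequality at `y` with the poles identified = `FK.theta_U_pivot` on the host transported along
  `some : V ↪ Option V` with the apex path `a – ⋆ – b` contracted (`FK.apExpC_map_apex_contract`, `FK.isTTSP_map_apex_reroot`);
* `realBox_A3n` — the pivot inequality at `y` read by the replica of a free virtual root = `FK.theta_U_pivot_nested` on the same host with
  the apex edge `a ⋆` free and `⋆ b` contracted (`FK.apExpC_map_apex_free₁/₂`).
The virtual apex makes all four statements hypothesis-free in the pole pair `ab` (which may or may not be an edge of `B`, even `y` itself).
[cite: Grimmett2006, §1.4 eq. (1.20) (p. 15); §3.8 Thm. (3.90) (pp. 61–62)] [cite: Wagner2006, Thm. 5.8(d), §5.3]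
-/

noncomputable section

namespace Summit.CriticalPhenomena.PercolationContinuityZ3.Theorems

namespace FK

namespace RootForm

open SimpleGraph Finset Literature.Probability.LatticeModels Literature.Probability.Percolation
open scoped Classical

section Arith
/-- threshold bookkeeping for the contracted apex path (state 0). [folklore] -/
theorem apex_le_iff₀ {e l n c c' K : ℤ} (h : e + 4 = l + 2 * n + c + c') : e + 4 - 2 * n ≤ K ↔ c + c' ≤ K - l := by omega
/-- threshold bookkeeping for the contracted apex path (state 1, relative to the level of state 0). [folklore] -/
theorem apex_le_iff₁ {e l n c c' K : ℤ} (l0 : ℤ) (h : e + 4 = l + 2 * n + c + c') :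
    e + 4 - 2 * n ≤ K ↔ l - l0 + c + c' ≤ K - l0 := by omega

/-- threshold bookkeeping for the half-free apex path (state 0). [folklore] -/
theorem apex_le_iff₂ {e l n c K : ℤ} (h : e + 3 = l + 2 * n + c) : e + 3 - 2 * n ≤ K ↔ c ≤ K - l := by omega
/-- threshold bookkeeping for the half-free apex path (state 1, relative to the level of state 0). [folklore] -/
theorem apex_le_iff₃ {e l n c K : ℤ} (l0 : ℤ) (h : e + 3 = l + 2 * n + c) : e + 3 - 2 * n ≤ K ↔ l - l0 + c ≤ K - l0 := by omega

end Arith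

variable {V : Type*} [Fintype V]
section RealBox
variable {M C : Finset (Sym2 V)} {a b u v : V}
omit [Fintype V] in
/-- The nested extension of a weight pair on `↥M.powerset` to all edge sets, glued along `y`: monotone on the subsets of `insert y M`.
[folklore] -/
theorem nestedExt_mono (y : Sym2 V) {h0 h1 : ↥M.powerset → ℝ} (m0 : Monotone h0) (m1 : Monotone h1) (le : ∀ β, h0 β ≤ h1 β) :
    ∀ ⦃A B : Finset (Sym2 V)⦄, A ⊆ B → B ⊆ insert y M →
      (if y ∈ A then h1 ⟨A.erase y ∩ M, Finset.mem_powerset.2 Finset.inter_subset_right⟩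
        else h0 ⟨A ∩ M, Finset.mem_powerset.2 Finset.inter_subset_right⟩) ≤
      (if y ∈ B then h1 ⟨B.erase y ∩ M, Finset.mem_powerset.2 Finset.inter_subset_right⟩
        else h0 ⟨B ∩ M, Finset.mem_powerset.2 Finset.inter_subset_right⟩) :=
  nestedTest_mono y (h₀ := fun Z => h0 ⟨Z ∩ M, Finset.mem_powerset.2 Finset.inter_subset_right⟩)
    (h₁ := fun Z => h1 ⟨Z ∩ M, Finset.mem_powerset.2 Finset.inter_subset_right⟩)
    (fun _ _ => le _)
    (fun A B hAB _ => m0 (show (⟨A ∩ M, _⟩ : ↥M.powerset) ≤ ⟨B ∩ M, _⟩ from Finset.inter_subset_inter hAB le_rfl))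
    (fun A B hAB _ => m1 (show (⟨A ∩ M, _⟩ : ↥M.powerset) ≤ ⟨B ∩ M, _⟩ from Finset.inter_subset_inter hAB le_rfl))

omit [Fintype V] in
/-- The glued extension agrees with `h0` at a configuration (state 0). [folklore] -/
theorem nestedExt_apply₀ {y : Sym2 V} (hyM : y ∉ M) (h0 h1 : ↥M.powerset → ℝ) (β : ↥M.powerset) :
    (if y ∈ β.1 then h1 ⟨β.1.erase y ∩ M, Finset.mem_powerset.2 Finset.inter_subset_right⟩
        else h0 ⟨β.1 ∩ M, Finset.mem_powerset.2 Finset.inter_subset_right⟩) = h0 β := by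
  have hXM : β.1 ⊆ M := Finset.mem_powerset.1 β.2
  rw [if_neg (fun h => hyM (hXM h))]
  congr 1
  exact Subtype.ext (Finset.inter_eq_left.2 hXM)

omit [Fintype V] in
/-- The glued extension agrees with `h1` at `insert y β` (state 1). [folklore] -/
theorem nestedExt_apply₁ {y : Sym2 V} (hyM : y ∉ M) (h0 h1 : ↥M.powerset → ℝ) (β : ↥M.powerset) :
    (if y ∈ insert y β.1 then h1 ⟨(insert y β.1).erase y ∩ M, Finset.mem_powerset.2 Finset.inter_subset_right⟩
        else h0 ⟨insert y β.1 ∩ M, Finset.mem_powerset.2 Finset.inter_subset_right⟩) = h1 β := by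
  have hXM : β.1 ⊆ M := Finset.mem_powerset.1 β.2
  rw [if_pos (Finset.mem_insert_self _ _)]
  congr 1
  exact Subtype.ext (by rw [Finset.erase_insert (fun h => hyM (hXM h))]; exact Finset.inter_eq_left.2 hXM)

/-! ### Consistency of the local types -/
/-- **(L4a-1) Every local type of a real box is consistent** (`y ∉ M`; no other hypothesis). [cite: Grimmett2006, §1.4 eq. (1.20) (p. 15)] -/
theorem realBox_consistent (hyM : s(u, v) ∉ M) (β : ↥M.powerset) :
    Cert.consistentB (realBox M C a b s(u, v) β).type = true := by
  obtain ⟨X, hX⟩ := β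
  have hXM : X ⊆ M := Finset.mem_powerset.1 hX
  have hyX : s(u, v) ∉ X := fun h => hyM (hXM h)
  have e1 : insert s(u, v) X ∪ C = insert s(u, v) (X ∪ C) := Finset.insert_union _ _ _
  have e2 : insert s(u, v) M \ X ∪ C = insert s(u, v) (M \ X ∪ C) := by
    rw [Finset.insert_sdiff_of_notMem _ hyX, Finset.insert_union]
  have e3 : insert s(u, v) M \ insert s(u, v) X ∪ C = M \ X ∪ C := by
    rw [Finset.insert_sdiff_insert, Finset.sdiff_insert_of_notMem hyM]
  have k1 := clusterCount_insert_add_ite (X ∪ C) u v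
  have k2 := clusterCount_insert_add_ite (M \ X ∪ C) u v
  -- monotonicity and the pivot constraints
  have m1 : (openGraph (↑(X ∪ C) : BondConfig V)).Reachable a b → (openGraph (↑(insert s(u, v) (X ∪ C)) : BondConfig V)).Reachable a b :=
    fun h => Wheel.reachable_insert_of_reachable _ _ h
  have m2 : (openGraph (↑(M \ X ∪ C) : BondConfig V)).Reachable a b →
      (openGraph (↑(insert s(u, v) (M \ X ∪ C)) : BondConfig V)).Reachable a b :=
    fun h => Wheel.reachable_insert_of_reachable _ _ h
  have p1 : (openGraph (↑(insert s(u, v) (X ∪ C)) : BondConfig V)).Reachable a b → ¬ (openGraph (↑(X ∪ C) : BondConfig V)).Reachable a b →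
      ¬ (openGraph (↑(X ∪ C) : BondConfig V)).Reachable u v := by
    intro h1 h0 huv
    rw [Wheel.reachable_coe_insert_iff] at h1
    rcases h1 with h1 | ⟨hau, hvb⟩ | ⟨hav, hub⟩
    · exact h0 h1
    · exact h0 (hau.trans (huv.trans hvb))
    · exact h0 (hav.trans (huv.symm.trans hub))
  have p2 : (openGraph (↑(insert s(u, v) (M \ X ∪ C)) : BondConfig V)).Reachable a b →
      ¬ (openGraph (↑(M \ X ∪ C) : BondConfig V)).Reachable a b → ¬ (openGraph (↑(M \ X ∪ C) : BondConfig V)).Reachable u v := by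
    intro h1 h0 huv
    rw [Wheel.reachable_coe_insert_iff] at h1
    rcases h1 with h1 | ⟨hau, hvb⟩ | ⟨hav, hub⟩
    · exact h0 h1
    · exact h0 (hau.trans (huv.trans hvb))
    · exact h0 (hav.trans (huv.symm.trans hub))
  simp only [realBox, realSDat, Base.BDat.type, Cert.consistentB, reachB, apExpC, e1, e2, e3]
  by_cases r1 : (openGraph (↑(X ∪ C) : BondConfig V)).Reachable u v <;>
    by_cases r2 : (openGraph (↑(M \ X ∪ C) : BondConfig V)).Reachable u v <;>
    by_cases c0 : (openGraph (↑(X ∪ C) : BondConfig V)).Reachable a b <;>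
    by_cases c1 : (openGraph (↑(insert s(u, v) (X ∪ C)) : BondConfig V)).Reachable a b <;>
    by_cases d1 : (openGraph (↑(M \ X ∪ C) : BondConfig V)).Reachable a b <;>
    by_cases d0 : (openGraph (↑(insert s(u, v) (M \ X ∪ C)) : BondConfig V)).Reachable a b <;>
    simp only [r1, r2, c0, c1, d0, d1, if_true, if_false, add_zero, decide_true, decide_false, Bool.not_true, Bool.not_false,
      Bool.true_or, Bool.or_true, Bool.false_or, Bool.or_false, Bool.true_and, Bool.and_true, Bool.false_and, Bool.and_false,
      decide_eq_true_eq, Bool.and_eq_true] at k1 k2 ⊢ <;>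
    first | omega | exact absurd (m1 c0) c1 | exact absurd (m2 d1) d0 | exact absurd r1 (p1 c1 c0) | exact absurd r2 (p2 d0 d1)

/-! ### A4n: root-U at an exact level, nested by the state of the special -/
/-- **(L4a-2) A4n for a real box**: `0 ≤ Σ_β (h₁(β)·[L¹(β) = K](c¹ − c̄¹) + h₀(β)·[L⁰(β) = K](c⁰ − c̄⁰))` for monotone `h₀ ≤ h₁` —
Theorem U (`FK.apUpcCLW_nonneg_of_isTTSP`) on the box with the level weight `1{· = K}` against the glued test function.
[cite: Grimmett2006, §3.8 Thm. (3.90) (pp. 61–62)] [cite: Wagner2006, Thm. 5.8(d), §5.3] -/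
theorem realBox_A4n {B : Finset (Sym2 V)} (hB : IsTTSP B a b) (hy : s(u, v) ∈ B) (hM : M ⊆ B.erase s(u, v)) (hC : C ⊆ B.erase s(u, v))
    {h0 h1 : ↥M.powerset → ℝ} (m0 : Monotone h0) (m1 : Monotone h1) (le : ∀ β, h0 β ≤ h1 β) (K : ℤ) :
    0 ≤ ∑ β, (h1 β * Base.gA4u (realBox M C a b s(u, v) β) K + h0 β * Base.gA4l (realBox M C a b s(u, v) β) K) := by
  have hyM : s(u, v) ∉ M := fun h => (Finset.mem_erase.1 (hM h)).1 rfl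
  have hM' : insert s(u, v) M ⊆ B := Finset.insert_subset hy (hM.trans (Finset.erase_subset _ _))
  have hC' : C ⊆ B := hC.trans (Finset.erase_subset _ _)
  have key := apUpcCLW_nonneg_of_isTTSP hB (insert s(u, v) M) C hM' hC' (fun n => if (n : ℤ) = K then 1 else 0)
    (fun n => by split_ifs <;> norm_num) _ (nestedExt_mono s(u, v) m0 m1 le)
  unfold apUpcCLW at key
  rw [Finset.sum_powerset_insert hyM, ← Finset.sum_add_distrib, ← Finset.sum_coe_sort] at key
  refine key.trans_eq (Finset.sum_congr rfl fun β _ => ?_)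
  dsimp only
  rw [nestedExt_apply₀ hyM, nestedExt_apply₁ hyM]
  obtain ⟨X, hX⟩ := β
  simp only [realBox, realSDat, Base.gA4u, Base.gA4l, Base.BDat.type, Cert.A4u, Cert.A4l, Cert.I, Cert.bi, reachB, apConn,
    decide_eq_true_eq]
  push_cast
  split_ifs <;> first | ring1 | (exfalso; omega)

end RealBox

/-! ### The host with a virtual apex -/
section ApexHost
variable {M C : Finset (Sym2 V)} {a b u v : V} {U : Type*} [Fintype U] {j : V ↪ U} {r : U}
omit [Fintype V] [Fintype U] in
/-- The image of the free set lies in the re-rooted apex host. [folklore] -/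
theorem map_subset_apexHost {B : Finset (Sym2 V)} (hM : M ⊆ B.erase s(u, v)) :
    M.map j.sym2Map ⊆ (insert s(j a, j b) (B.map j.sym2Map ∪ ({s(j a, r)} ∪ {s(r, j b)}))).erase s(j u, j v) := by
  intro e' he'
  rw [Finset.mem_map] at he'
  obtain ⟨e, he, rfl⟩ := he'
  have he2 := Finset.mem_erase.1 (hM he)
  refine Finset.mem_erase.2 ⟨fun h => he2.1 (j.sym2Map.injective (by rw [h, sym2Map_mk])), ?_⟩
  exact Finset.mem_insert_of_mem (Finset.mem_union_left _ ((Finset.mem_map' _).2 he2.2))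

omit [Fintype V] [Fintype U] in
/-- The apex path lies in the re-rooted apex host. [folklore] -/
theorem path_subset_apexHost (hr : r ∉ Set.range j) (B : Finset (Sym2 V)) :
    ({s(j a, r)} ∪ {s(r, j b)} : Finset (Sym2 U)) ⊆
      (insert s(j a, j b) (B.map j.sym2Map ∪ ({s(j a, r)} ∪ {s(r, j b)}))).erase s(j u, j v) := by
  intro e he
  have hre : r ∈ e := by
    rcases Finset.mem_union.1 he with h | h <;> rw [Finset.mem_singleton] at h <;> subst h
    · exact Sym2.mem_mk_right _ _
    · exact Sym2.mem_mk_left _ _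
  refine Finset.mem_erase.2 ⟨?_, Finset.mem_insert_of_mem (Finset.mem_union_right _ he)⟩
  rintro rfl
  rcases Sym2.mem_iff.1 hre with h | h
  · exact hr ⟨u, h.symm⟩
  · exact hr ⟨v, h.symm⟩

omit [Fintype U] in
/-- The pulled-back weight `X' ↦ h(j⁻¹ X' ∩ M)` is monotone. [folklore] -/
theorem pullWeight_mono {h : ↥M.powerset → ℝ} (mh : Monotone h) :
    ∀ ⦃X' Y' : Finset (Sym2 U)⦄, X' ⊆ Y' →
      h ⟨(Finset.univ.filter fun e : Sym2 V => j.sym2Map e ∈ X') ∩ M, Finset.mem_powerset.2 Finset.inter_subset_right⟩ ≤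
      h ⟨(Finset.univ.filter fun e : Sym2 V => j.sym2Map e ∈ Y') ∩ M, Finset.mem_powerset.2 Finset.inter_subset_right⟩ :=
  fun _ _ hXY => mh (show (⟨_, _⟩ : ↥M.powerset) ≤ ⟨_, _⟩ from Finset.inter_subset_inter (pull_mono j hXY) le_rfl)

omit [Fintype U] in
/-- The pulled-back weight at an image configuration `j X`, `X ⊆ M`. [folklore] -/
theorem pullWeight_map (h : ↥M.powerset → ℝ) (β : ↥M.powerset) :
    h ⟨(Finset.univ.filter fun e : Sym2 V => j.sym2Map e ∈ β.1.map j.sym2Map) ∩ M, Finset.mem_powerset.2 Finset.inter_subset_right⟩ = h β := by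
  congr 1
  apply Subtype.ext
  dsimp only
  rw [pull_map]
  exact Finset.inter_eq_left.2 (Finset.mem_powerset.1 β.2)

omit [Fintype U] in
/-- The pulled-back weight at `j (insert y X)`, `y ∉ M`, `X ⊆ M`. [folklore] -/
theorem pullWeight_map_insert {y : Sym2 V} (hyM : y ∉ M) (h : ↥M.powerset → ℝ) (β : ↥M.powerset) :
    h ⟨(Finset.univ.filter fun e : Sym2 V => j.sym2Map e ∈ (insert y β.1).map j.sym2Map) ∩ M,
      Finset.mem_powerset.2 Finset.inter_subset_right⟩ = h β := by
  congr 1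
  apply Subtype.ext
  dsimp only
  rw [pull_map, Finset.insert_inter_of_notMem hyM]
  exact Finset.inter_eq_left.2 (Finset.mem_powerset.1 β.2)

/-- **(L4a-3) A1 for a real box, along an embedding with a fresh apex**: `0 ≤ Σ_β h(β)·([L⁰+c⁰+c̄⁰ ≤ K] − [L¹+c¹+c̄¹ ≤ K])` for monotone
`h` — `FK.theta_U_pivot` on `j B ∪ {j a r, r j b, j a j b}` re-rooted at `j y`, with the apex path contracted.
[cite: Grimmett2006, §3.8 Thm. (3.90) (pp. 61–62)] -/
theorem realBox_A1_apex (hr : r ∉ Set.range j) {B : Finset (Sym2 V)} (hB : IsTTSP B a b) (hy : s(u, v) ∈ B)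
    (hM : M ⊆ B.erase s(u, v)) (hC : C ⊆ B.erase s(u, v)) {h : ↥M.powerset → ℝ} (mh : Monotone h) (K : ℤ) :
    0 ≤ ∑ β, h β * Base.gA1 (realBox M C a b s(u, v) β) K := by
  have hyM : s(u, v) ∉ M := fun h => (Finset.mem_erase.1 (hM h)).1 rfl
  obtain ⟨N0, hN0⟩ : ∃ N0, Nat.card {x : U // x ∉ Set.range j} = N0 := ⟨_, rfl⟩
  have hE := isTTSP_map_apex_reroot hB hr hy
  have hMs := map_subset_apexHost (j := j) (r := r) (a := a) (b := b) hM
  have hCs : C.map j.sym2Map ∪ ({s(j a, r)} ∪ {s(r, j b)}) ⊆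
      (insert s(j a, j b) (B.map j.sym2Map ∪ ({s(j a, r)} ∪ {s(r, j b)}))).erase s(j u, j v) :=
    Finset.union_subset (map_subset_apexHost hC) (path_subset_apexHost hr B)
  have hzM : s(j u, j v) ∉ M.map j.sym2Map := by rw [← sym2Map_mk, Finset.mem_map']; exact hyM
  -- the antitone weight `1{n + 4 − 2 N0 ≤ K}` and the pulled-back weight
  have key := theta_U_pivot hE hMs hCs hzM (W := fun n => if (n : ℤ) + 4 - 2 * N0 ≤ K then (1 : ℝ) else 0)
    (fun n => by
      split_ifs with h1 h2
      · exact le_rfl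
      · push_cast at h1; omega
      · exact zero_le_one
      · exact le_rfl)
    (H := fun X' => h ⟨(Finset.univ.filter fun e : Sym2 V => j.sym2Map e ∈ X') ∩ M, Finset.mem_powerset.2 Finset.inter_subset_right⟩)
    (fun X' Y' hXY _ => pullWeight_mono mh hXY)
    (fun X' => by
      show h ⟨_, _⟩ = h ⟨_, _⟩
      congr 1
      apply Subtype.ext
      dsimp only
      rw [← sym2Map_mk, pull_insert_map, Finset.insert_inter_of_notMem hyM]) 0
  rw [show insert s(j u, j v) (M.map j.sym2Map) = (insert s(u, v) M).map j.sym2Map by rw [Finset.map_insert, sym2Map_mk],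
    ← sum_powerset_map, Finset.sum_powerset_insert hyM, ← Finset.sum_add_distrib, ← Finset.sum_coe_sort] at key
  refine key.trans_eq (Finset.sum_congr rfl fun β _ => ?_)
  rw [pullWeight_map h β, pullWeight_map_insert hyM h β]
  have k0 := apExpC_map_apex_contract hr (insert s(u, v) M) C β.1 a b
  have k1 := apExpC_map_apex_contract hr (insert s(u, v) M) C (insert s(u, v) β.1) a b
  rw [hN0] at k0 k1
  have n0 : s(j u, j v) ∉ β.1.map j.sym2Map := by
    rw [← sym2Map_mk, Finset.mem_map']; exact fun h => hyM (Finset.mem_powerset.1 β.2 h)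
  have n1 : s(j u, j v) ∈ (insert s(u, v) β.1).map j.sym2Map := by
    rw [← sym2Map_mk, Finset.mem_map']; exact Finset.mem_insert_self _ _
  simp only [n0, n1, if_true, if_false, add_zero]
  obtain ⟨X, hX⟩ := β
  simp only [realBox, realSDat, Base.gA1, Base.BDat.type, Cert.A1, Cert.I, Cert.bi, reachB, decide_eq_true_eq]
  zify at k0 k1
  simp only [apex_le_iff₀ k0, apex_le_iff₁ (apExpC (insert s(u, v) M) C X : ℤ) k1]
  push_cast
  ring

/-- **(L4a-4) A3n for a real box, along an embedding with a fresh apex**: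
`0 ≤ Σ_β (h₁(β)([L⁰+c⁰ ≤ K] − [L¹+c¹ ≤ K]) + h₀(β)([L⁰+c̄⁰ ≤ K] − [L¹+c̄¹ ≤ K]))` for monotone `h₀ ≤ h₁` — `FK.theta_U_pivot_nested`
on the apex host with the apex edge `j a r` FREE (read by the nested pair) and `r j b` contracted.
[cite: Grimmett2006, §3.8 Thm. (3.90) (pp. 61–62)] -/
theorem realBox_A3n_apex (hr : r ∉ Set.range j) {B : Finset (Sym2 V)} (hB : IsTTSP B a b) (hy : s(u, v) ∈ B)
    (hM : M ⊆ B.erase s(u, v)) (hC : C ⊆ B.erase s(u, v)) {h0 h1 : ↥M.powerset → ℝ} (m0 : Monotone h0) (m1 : Monotone h1)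
    (le : ∀ β, h0 β ≤ h1 β) (K : ℤ) :
    0 ≤ ∑ β, (h1 β * Base.gA3u (realBox M C a b s(u, v) β) K + h0 β * Base.gA3l (realBox M C a b s(u, v) β) K) := by
  have hyM : s(u, v) ∉ M := fun h => (Finset.mem_erase.1 (hM h)).1 rfl
  obtain ⟨N0, hN0⟩ : ∃ N0, Nat.card {x : U // x ∉ Set.range j} = N0 := ⟨_, rfl⟩
  have hE := isTTSP_map_apex_reroot hB hr hy
  have hP := path_subset_apexHost (a := a) (b := b) (u := u) (v := v) hr B
  have heE : s(j a, r) ∈ (insert s(j a, j b) (B.map j.sym2Map ∪ ({s(j a, r)} ∪ {s(r, j b)}))).erase s(j u, j v) :=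
    hP (Finset.mem_union_left _ (Finset.mem_singleton_self _))
  have hfE : s(r, j b) ∈ (insert s(j a, j b) (B.map j.sym2Map ∪ ({s(j a, r)} ∪ {s(r, j b)}))).erase s(j u, j v) :=
    hP (Finset.mem_union_right _ (Finset.mem_singleton_self _))
  have hNs : insert s(j a, r) (M.map j.sym2Map) ⊆ (insert s(j a, j b) (B.map j.sym2Map ∪ ({s(j a, r)} ∪ {s(r, j b)}))).erase s(j u, j v) :=
    Finset.insert_subset heE (map_subset_apexHost hM)
  have hCs : C.map j.sym2Map ∪ {s(r, j b)} ⊆ (insert s(j a, j b) (B.map j.sym2Map ∪ ({s(j a, r)} ∪ {s(r, j b)}))).erase s(j u, j v) :=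
    Finset.union_subset (map_subset_apexHost hC) (Finset.singleton_subset_iff.2 hfE)
  have heM : s(j a, r) ∉ M.map j.sym2Map := fun h => apex_notMem_of_mem_map hr M _ h (Sym2.mem_mk_right _ _)
  have hzM : s(j u, j v) ∉ M.map j.sym2Map := by rw [← sym2Map_mk, Finset.mem_map']; exact hyM
  have hze : s(j u, j v) ≠ s(j a, r) := by
    intro h
    have hr' : r ∈ s(j u, j v) := h ▸ Sym2.mem_mk_right _ _
    rcases Sym2.mem_iff.1 hr' with h' | h'
    · exact hr ⟨u, h'.symm⟩
    · exact hr ⟨v, h'.symm⟩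
  have hzN : s(j u, j v) ∉ insert s(j a, r) (M.map j.sym2Map) := by
    rw [Finset.mem_insert, not_or]; exact ⟨hze, hzM⟩
  have hbl : ∀ (g : ↥M.powerset → ℝ) (X' : Finset (Sym2 U)),
      g ⟨(Finset.univ.filter fun e : Sym2 V => j.sym2Map e ∈ insert s(j u, j v) X') ∩ M, Finset.mem_powerset.2 Finset.inter_subset_right⟩ =
      g ⟨(Finset.univ.filter fun e : Sym2 V => j.sym2Map e ∈ X') ∩ M, Finset.mem_powerset.2 Finset.inter_subset_right⟩ := by
    intro g X'
    congr 1
    apply Subtype.ext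
    dsimp only
    rw [← sym2Map_mk, pull_insert_map, Finset.insert_inter_of_notMem hyM]
  have key := theta_U_pivot_nested hE hNs hCs hzN heM (W := fun n => if (n : ℤ) + 3 - 2 * N0 ≤ K then (1 : ℝ) else 0)
    (fun n => by
      split_ifs with h1 h2
      · exact le_rfl
      · push_cast at h1; omega
      · exact zero_le_one
      · exact le_rfl)
    (H₀ := fun X' => h0 ⟨(Finset.univ.filter fun e : Sym2 V => j.sym2Map e ∈ X') ∩ M, Finset.mem_powerset.2 Finset.inter_subset_right⟩)
    (H₁ := fun X' => h1 ⟨(Finset.univ.filter fun e : Sym2 V => j.sym2Map e ∈ X') ∩ M, Finset.mem_powerset.2 Finset.inter_subset_right⟩)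
    (fun A _ => le _) (fun X' Y' hXY _ => pullWeight_mono m0 hXY) (fun X' Y' hXY _ => pullWeight_mono m1 hXY)
    (hbl h0) (hbl h1) 0
  rw [show insert s(j u, j v) (M.map j.sym2Map) = (insert s(u, v) M).map j.sym2Map by rw [Finset.map_insert, sym2Map_mk],
    ← sum_powerset_map, Finset.sum_powerset_insert hyM, ← Finset.sum_add_distrib, ← Finset.sum_coe_sort] at key
  refine key.trans_eq (Finset.sum_congr rfl fun β _ => ?_)
  rw [pullWeight_map h0 β, pullWeight_map h1 β, pullWeight_map_insert hyM h0 β, pullWeight_map_insert hyM h1 β]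
  have k0u := apExpC_map_apex_free₁ hr (insert s(u, v) M) β.1 C a b
  have k0l := apExpC_map_apex_free₂ hr (insert s(u, v) M) β.1 C a b
  have k1u := apExpC_map_apex_free₁ hr (insert s(u, v) M) (insert s(u, v) β.1) C a b
  have k1l := apExpC_map_apex_free₂ hr (insert s(u, v) M) (insert s(u, v) β.1) C a b
  rw [hN0] at k0u k0l k1u k1l
  have n0 : s(j u, j v) ∉ β.1.map j.sym2Map := by
    rw [← sym2Map_mk, Finset.mem_map']; exact fun h => hyM (Finset.mem_powerset.1 β.2 h)
  have n1 : s(j u, j v) ∈ (insert s(u, v) β.1).map j.sym2Map := by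
    rw [← sym2Map_mk, Finset.mem_map']; exact Finset.mem_insert_self _ _
  simp only [n0, n1, if_true, if_false, add_zero]
  obtain ⟨X, hX⟩ := β
  simp only [realBox, realSDat, Base.gA3u, Base.gA3l, Base.BDat.type, Cert.A3u, Cert.A3l, Cert.I, Cert.bi, reachB, decide_eq_true_eq]
  zify at k0u k0l k1u k1l
  simp only [apex_le_iff₂ k0u, apex_le_iff₂ k0l, apex_le_iff₃ (apExpC (insert s(u, v) M) C X : ℤ) k1u,
    apex_le_iff₃ (apExpC (insert s(u, v) M) C X : ℤ) k1l]
  push_cast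
  ring

end ApexHost

/-! ### The four hypotheses of THEOREM G27 for real boxes (vertex type `Option V`, apex `none`) -/
section Final
variable {M C : Finset (Sym2 V)} {a b u v : V}
omit [Fintype V] in
/-- `none` is off the range of `some`. [folklore] -/
theorem none_notMem_range_some : (none : Option V) ∉ Set.range (Function.Embedding.some : V ↪ Option V) := by
  rintro ⟨x, hx⟩; exact Option.some_ne_none x hx

/-- **(L4a-3) A1 for a real box.** [cite: Grimmett2006, §3.8 Thm. (3.90) (pp. 61–62)] -/
theorem realBox_A1 {B : Finset (Sym2 V)} (hB : IsTTSP B a b) (hy : s(u, v) ∈ B) (hM : M ⊆ B.erase s(u, v)) (hC : C ⊆ B.erase s(u, v))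
    {h : ↥M.powerset → ℝ} (mh : Monotone h) (K : ℤ) : 0 ≤ ∑ β, h β * Base.gA1 (realBox M C a b s(u, v) β) K :=
  realBox_A1_apex none_notMem_range_some hB hy hM hC mh K

/-- **(L4a-4) A3n for a real box.** [cite: Grimmett2006, §3.8 Thm. (3.90) (pp. 61–62)] -/
theorem realBox_A3n {B : Finset (Sym2 V)} (hB : IsTTSP B a b) (hy : s(u, v) ∈ B) (hM : M ⊆ B.erase s(u, v)) (hC : C ⊆ B.erase s(u, v))
    {h0 h1 : ↥M.powerset → ℝ} (m0 : Monotone h0) (m1 : Monotone h1) (le : ∀ β, h0 β ≤ h1 β) (K : ℤ) :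
    0 ≤ ∑ β, (h1 β * Base.gA3u (realBox M C a b s(u, v) β) K + h0 β * Base.gA3l (realBox M C a b s(u, v) β) K) :=
  realBox_A3n_apex none_notMem_range_some hB hy hM hC m0 m1 le K

/-- **THEOREM G27 FOR REAL BOXES.**  For any two real boxes with common poles `c, d` (each two-terminal series–parallel between `c, d`, with
its special edge and its cell), the nested root functional ♣ = `Mt (thetaPair (realBox …) (realBox …))` is nonnegative against every
monotone nested nonnegative weight pair — `FK.RootForm.Base.thetaPair_Mt_nonneg` with its eight hypotheses discharged by
`realBox_consistent / _A1 / _A3n / _A4n`.  (That this abstract pair environment is the environment of the host `B_y ∥ B_z` up to a level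
constant is the root identity of the sibling file.) [cite: Grimmett2006, §3.8 Thm. (3.90) (pp. 61–62)] [cite: Wagner2006, Thm. 5.8(d), §5.3] -/
theorem realPair_Mt_nonneg {B B' : Finset (Sym2 V)} {c d : V} (hB : IsTTSP B c d) (hB' : IsTTSP B' c d) {uy vy uz vz : V}
    (hy : s(uy, vy) ∈ B) (hz : s(uz, vz) ∈ B') {My Cy Mz Cz : Finset (Sym2 V)}
    (hMy : My ⊆ B.erase s(uy, vy)) (hCy : Cy ⊆ B.erase s(uy, vy)) (hMz : Mz ⊆ B'.erase s(uz, vz)) (hCz : Cz ⊆ B'.erase s(uz, vz))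
    {H0 H1 : ↥My.powerset × ↥Mz.powerset → ℝ} (m0 : Monotone H0) (m1 : Monotone H1) (n0 : ∀ p, 0 ≤ H0 p) (le : ∀ p, H0 p ≤ H1 p)
    (J : ℤ) :
    0 ≤ Mt (Base.thetaPair (realBox My Cy c d s(uy, vy)) (realBox Mz Cz c d s(uz, vz))) H0 H1 J :=
  have hyM : s(uy, vy) ∉ My := fun h => (Finset.mem_erase.1 (hMy h)).1 rfl
  have hzM : s(uz, vz) ∉ Mz := fun h => (Finset.mem_erase.1 (hMz h)).1 rfl
  Base.thetaPair_Mt_nonneg _ _ (fun β => realBox_consistent hyM β) (fun γ => realBox_consistent hzM γ)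
    (fun _ mh _ K => realBox_A1 hB hy hMy hCy mh K)
    (fun _ _ m0' m1' _ le' K => realBox_A3n hB hy hMy hCy m0' m1' le' K)
    (fun _ _ m0' m1' _ le' K => realBox_A4n hB hy hMy hCy m0' m1' le' K)
    (fun _ mh _ K => realBox_A1 hB' hz hMz hCz mh K)
    (fun _ _ m0' m1' _ le' K => realBox_A3n hB' hz hMz hCz m0' m1' le' K)
    (fun _ _ m0' m1' _ le' K => realBox_A4n hB' hz hMz hCz m0' m1' le' K)
    m0 m1 n0 le J

end Final

end RootForm

end FK

end Summit.CriticalPhenomena.PercolationContinuityZ3.Theorems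

end
-- build-touch 2026-08-25T05:00Z T1 (lead g17): re-land of p388133, declarations byte-identical
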